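import Summits.CriticalPhenomena.PercolationContinuityZ3.Theorems.PercNearOneGluingNoHeavyQuantIncomeCriterion
import Summits.CriticalPhenomena.PercolationContinuityZ3.Theorems.PercNearOneGluingNoHeavyQuantGateMoveBlobCellsZero
import Summits.CriticalPhenomena.PercolationContinuityZ3.Theorems.PercNearOneGluingNoHeavyQuantGateMoveBlobCells
import Summits.CriticalPhenomena.PercolationContinuityZ3.Theorems.PercNearOneGluingNoHeavyQuantSliceHeavy
import Summits.CriticalPhenomena.PercolationContinuityZ3.Theorems.PercNearOneGluingNoHeavyQuantGatedSliceWindow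
import Summits.CriticalPhenomena.PercolationContinuityZ3.Theorems.PercNearOneGluingNoHeavyQuantGatedSliceMixLawQRouting
import HarnessLib

/-!
# QUANT lane R8, T-DEC, leg (III), blob case — `LawDec.GatedSliceMixLaw'`, Q-ALONE side: the ROUTING THEOREM for `Q = zδ₀ + (1−z)·slice {k₁,k₂;λ} a g`
# in the LOW-TOP classes (cell QK: the top `k₂ ≤ j` is a `t`-low, the twin `k₁ + a ≤ j` a mid, `k₂ + a` a giant; `k₁` a `t`-low or `0`)

builds on p205010 (kernel theorem, internal audit signed; external expert review pending)

Support file (`--supports stmt-CriticalPhenomena-4575`), QUANT lane seat prim-quant-arm-1 (gen 41), rung R8 of `run/shared/lean/prim/quant/LADDER.md`.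
Theorems only, standard axioms, no sorries, no definitions.  Companion of `…QuantGatedSliceMixLawQRouting` (lows `{0,k₁}`) and `…QRoutingDeep`
(lows `{0,k₁,k₁+a}`): here the lows are `{0, k₁, k₂}`, the absorbers the twin `P = k₁ + a` (`P ≤ j`, `t ≤ 2P`) and the giant `G = k₂ + a ≥ j+1`;
`k₁ = 0` is allowed (then the zero atom carries `z + A` and the row of `k₁` is empty, `x₁P = x₁G = 0`).
`mixLawQ_decAtT_of_routing_low`: amounts `x₁P + x₁G = A` (if `k₁ ≥ 1`), `x₂P + x₂G = C`, nonnegative, `x₁P > 0 ⟹ t < k₁ + P`, within capacity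
(`usage(k₁,P)x₁P + usage(k₂,P)x₂P ≤ B`, `usage(k₁,G)x₁G + usage(k₂,G)x₂G ≤ D`), and the zero fits the priced leftovers
(`t·(z + (A − x₁P − x₁G)) ≤ κ(P)(B − load P) + t(1−y)/y·(D − load G)`, `κ(P) = (P − t)⁺`) ⟹ `Q` is `DECAtT y t j (M+a)` (`k₂` is compatible with
`P` whenever `x₂P > 0`: then `C > 0`, `g < 1`, `t < k₂ + a ≤ k₂ + P`).  `mixLawQ_decAtT_of_lowsAbsorb`: if the twin absorbs ALL the nonzero lows
(`usage(k₁,P)·A·[k₁ ≥ 1] + usage(k₂,P)·C ≤ B`) no offer hypothesis is needed — the zero fits by the mean identity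
`t·z = (k₁−t)A + (P−t)B + (K−t)C + (G−t)D`, termwise (`usage_mid_mul_le`, `yG ≤ t`), as in `…QMidsAbsorb`.  Exact census (`work/explore/qQK.py`):
the top-first split certifies every instance of cell QK (25 579 / 0).
HONEST STATUS: `GatedSliceMixLaw'` (regime R), CW, `GateMove`, `GatedConvEmptyFree`, `SingleGateConvClosed`, `TreeDEC`, `FarTreeRow` OPEN; RATE unchanged.

* **`LawDec.mixLawQ_decAtT_of_routing_low`**, **`LawDec.mixLawQ_decAtT_of_lowsAbsorb`**.

[this work]; offers criterion: prim-quant-arm-1 g39; flow form: prim-quant-stmt g22–g26; node: prim-quant-stmt g29 (this lane).  Nothing here is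
cited as a published result.  The gluing rows served [cite: KozmaNitzan2024, Conjecture 3 (p. 15)]; product measure [cite: Grimmett1999, §1.3 p. 10].
-/

noncomputable section
namespace Summit.CriticalPhenomena.PercolationContinuityZ3.Theorems

namespace Quant

open Finset
/-- the two-point law `{lo, hi; g}` (as in `…QuantLawDEC`) -/
local notation3 "TP[" lo ", " hi ", " g ", " h "]" =>
  (g : ℝ) * (if (h : ℕ) = (hi : ℕ) then (1 : ℝ) else 0) + (1 - (g : ℝ)) * (if (h : ℕ) = (lo : ℕ) then (1 : ℝ) else 0)

namespace LawDec

/-- **THE EXPLICIT ROUTING THEOREM FOR `Q` WITH A LOW TOP** (cell QK).  See the file header. [this work] -/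
theorem mixLawQ_decAtT_of_routing_low (y z g S lam : ℝ) (a j M k₁ k₂ : ℕ) (x₁P x₁G x₂P x₂G : ℝ)
    (hy0 : 0 < y) (hy1 : y < 1) (hz0 : 0 ≤ z) (hz1 : z < 1) (hg1 : g ≤ 1) (hyg : y ≤ (1 - z) * g) (ha : 1 ≤ a)
    (hta : y * (M : ℝ) ≤ S) (hk : k₁ ≤ k₂) (hk₂M : k₂ ≤ M) (hlam0 : 0 ≤ lam) (hlam1 : lam ≤ 1)
    (hmean : (1 - z) * ((k₁ : ℝ) + ((k₂ : ℝ) - k₁) * lam) = S)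
    -- regime: `k₁` a `t`-low or zero, the twin `k₁ + a ≤ j` a mid, the top `k₂ ≤ j` a `t`-low, `k₂ + a` a giant
    (hk₁j : k₁ ≤ j) (hk₁low : 2 * (k₁ : ℝ) < S + (a : ℝ) * g * (1 - z))
    (hPj : k₁ + a ≤ j) (hPmid : S + (a : ℝ) * g * (1 - z) ≤ 2 * ((k₁ + a : ℕ) : ℝ))
    (hKj : k₂ ≤ j) (hKlow : 2 * (k₂ : ℝ) < S + (a : ℝ) * g * (1 - z))
    (hG : j + 1 ≤ k₂ + a)
    (hx₁P0 : 0 ≤ x₁P) (hx₁G0 : 0 ≤ x₁G) (hx₂P0 : 0 ≤ x₂P) (hx₂G0 : 0 ≤ x₂G)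
    (hsplit₁ : 1 ≤ k₁ → x₁P + x₁G = (1 - z) * (1 - lam) * (1 - g)) (hzero₁ : k₁ = 0 → x₁P = 0 ∧ x₁G = 0)
    (hsplit₂ : x₂P + x₂G = (1 - z) * lam * (1 - g))
    (hP₁comp : 0 < x₁P → S + (a : ℝ) * g * (1 - z) < (k₁ : ℝ) + ((k₁ + a : ℕ) : ℝ))
    (hcapP : usage y (S + (a : ℝ) * g * (1 - z)) j k₁ (k₁ + a) * x₁P + usage y (S + (a : ℝ) * g * (1 - z)) j k₂ (k₁ + a) * x₂P
      ≤ (1 - z) * (1 - lam) * g)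
    (hcapG : usage y (S + (a : ℝ) * g * (1 - z)) j k₁ (k₂ + a) * x₁G + usage y (S + (a : ℝ) * g * (1 - z)) j k₂ (k₂ + a) * x₂G
      ≤ (1 - z) * lam * g)
    (hoffer : (S + (a : ℝ) * g * (1 - z)) * (z + ((1 - z) * (1 - lam) * (1 - g) - x₁P - x₁G)) ≤
        (if S + (a : ℝ) * g * (1 - z) < ((k₁ + a : ℕ) : ℝ) then ((k₁ + a : ℕ) : ℝ) - (S + (a : ℝ) * g * (1 - z)) else 0)
          * ((1 - z) * (1 - lam) * g
              - (usage y (S + (a : ℝ) * g * (1 - z)) j k₁ (k₁ + a) * x₁P + usage y (S + (a : ℝ) * g * (1 - z)) j k₂ (k₁ + a) * x₂P))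
        + (S + (a : ℝ) * g * (1 - z)) * (1 - y) / y
          * ((1 - z) * lam * g
              - (usage y (S + (a : ℝ) * g * (1 - z)) j k₁ (k₂ + a) * x₁G
                  + usage y (S + (a : ℝ) * g * (1 - z)) j k₂ (k₂ + a) * x₂G))) :
    DECAtT y (S + (a : ℝ) * g * (1 - z)) j (M + a)
      (fun p => z * (if p = 0 then (1 : ℝ) else 0) + (1 - z) * slice (fun q => TP[k₁, k₂, lam, q]) a g p) := by
  classical
  set t : ℝ := S + (a : ℝ) * g * (1 - z) with ht
  set A : ℝ := (1 - z) * (1 - lam) * (1 - g) with hA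
  set B : ℝ := (1 - z) * (1 - lam) * g with hB
  set C : ℝ := (1 - z) * lam * (1 - g) with hC
  set D : ℝ := (1 - z) * lam * g with hD
  have hg0 : 0 < g := by
    by_contra hc
    linarith [mul_nonpos_of_nonneg_of_nonpos (by linarith : (0:ℝ) ≤ 1 - z) (not_lt.1 hc)]
  have h1z : 0 < 1 - z := by linarith
  have hA0 : 0 ≤ A := mul_nonneg (mul_nonneg h1z.le (by linarith)) (by linarith)
  have hB0 : 0 ≤ B := mul_nonneg (mul_nonneg h1z.le (by linarith)) hg0.le
  have hC0 : 0 ≤ C := mul_nonneg (mul_nonneg h1z.le hlam0) (by linarith)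
  have hD0 : 0 ≤ D := mul_nonneg (mul_nonneg h1z.le hlam0) hg0.le
  have ha0 : (0 : ℝ) < a := by exact_mod_cast (Nat.lt_of_lt_of_le Nat.zero_lt_one ha)
  have hkr : (k₁ : ℝ) ≤ k₂ := by exact_mod_cast hk
  have htpos : 0 < t := by
    have : (0 : ℝ) ≤ k₁ := Nat.cast_nonneg k₁
    linarith
  have hk₁k₂ : k₁ < k₂ := by omega
  have hKP : k₂ < k₁ + a := by
    have h1 : 2 * (k₂ : ℝ) < 2 * ((k₁ + a : ℕ) : ℝ) := lt_of_lt_of_le hKlow hPmid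
    exact_mod_cast (by linarith : (k₂ : ℝ) < ((k₁ + a : ℕ) : ℝ))
  have hPK : k₁ + a ≠ k₂ := by omega
  have hPne : k₁ + a ≠ k₁ := by omega
  have hKne : k₂ ≠ k₁ := by omega
  have hGne : k₂ + a ≠ k₁ := by omega
  have hGneP : k₂ + a ≠ k₁ + a := by omega
  have hGneK : k₂ + a ≠ k₂ := by omega
  have hK0 : k₂ ≠ 0 := by omega
  have hPN : k₁ + a < M + a + 1 := by omega
  have hGN : k₂ + a < M + a + 1 := by omega
  have hPr : ((k₁ + a : ℕ) : ℝ) = (k₁ : ℝ) + a := by push_cast; ring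
  have hP₂comp : 0 < x₂P → t < (k₂ : ℝ) + ((k₁ + a : ℕ) : ℝ) := by
    intro hx
    have hCpos : 0 < C := by
      have h1 : x₂P ≤ C := by linarith [hsplit₂]
      linarith
    have hg1' : g < 1 := by
      by_contra hc
      have : g = 1 := le_antisymm hg1 (not_lt.1 hc)
      rw [hC, this, sub_self, mul_zero] at hCpos
      exact lt_irrefl _ hCpos
    have hS : S ≤ (k₂ : ℝ) := by
      rw [← hmean]
      have hd0 : 0 ≤ (k₂ : ℝ) - k₁ := by linarith
      have h1 : ((k₂ : ℝ) - k₁) * lam ≤ (k₂ : ℝ) - k₁ := mul_le_of_le_one_right hd0 hlam1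
      have h1' : 0 ≤ ((k₂ : ℝ) - k₁) * lam := mul_nonneg hd0 hlam0
      have h0 : 0 ≤ (k₁ : ℝ) + ((k₂ : ℝ) - k₁) * lam := by
        have : (0 : ℝ) ≤ k₁ := Nat.cast_nonneg k₁
        linarith
      calc (1 - z) * ((k₁ : ℝ) + ((k₂ : ℝ) - k₁) * lam) ≤ 1 * ((k₁ : ℝ) + ((k₂ : ℝ) - k₁) * lam) :=
            mul_le_mul_of_nonneg_right (by linarith) h0
        _ ≤ k₂ := by linarith
    have h2 : (a : ℝ) * g * (1 - z) < a := by
      have h3 : g * (1 - z) ≤ g := mul_le_of_le_one_right hg0.le (by linarith)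
      have h4 : (a : ℝ) * (g * (1 - z)) < (a : ℝ) * 1 := mul_lt_mul_of_pos_left (by linarith) ha0
      linarith [mul_assoc (a : ℝ) g (1 - z)]
    have : (0 : ℝ) ≤ k₁ := Nat.cast_nonneg k₁
    rw [hPr, ht]; linarith
  obtain ⟨Q, hQdef⟩ : ∃ Q : ℕ → ℝ, ∀ p, Q p = z * (if p = 0 then (1 : ℝ) else 0) + A * (if p = k₁ then (1 : ℝ) else 0)
      + B * (if p = k₁ + a then (1 : ℝ) else 0) + C * (if p = k₂ then (1 : ℝ) else 0)
      + D * (if p = k₂ + a then (1 : ℝ) else 0) := ⟨fun p => _, fun p => rfl⟩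
  have hQp : ∀ p, z * (if p = 0 then (1 : ℝ) else 0) + (1 - z) * slice (fun q => TP[k₁, k₂, lam, q]) a g p = Q p := by
    intro p
    rw [hQdef, mixLawQ_eq_atoms]
  obtain ⟨q0', qM', q1', -⟩ := gateCell_laws z g lam a M k₁ k₂ hz0 hz1.le hg0.le hg1 hlam0 hlam1 (hk.trans hk₂M) hk₂M
  have q0 : ∀ h, 0 ≤ Q h := fun h => by rw [← hQp h]; exact q0' h
  have qM : ∀ h, M + a < h → Q h = 0 := fun h hh => by rw [← hQp h]; exact qM' h hh
  have q1 : ∑ h ∈ Finset.range (M + a + 1), Q h = 1 := by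
    rw [← q1']; exact Finset.sum_congr rfl fun h _ => (hQp h).symm
  have hQ0 : Q 0 = z + A * (if (0 : ℕ) = k₁ then (1 : ℝ) else 0) := by
    rw [hQdef, if_pos rfl, if_neg (by omega : (0:ℕ) ≠ k₁ + a), if_neg (by omega : (0:ℕ) ≠ k₂),
      if_neg (by omega : (0:ℕ) ≠ k₂ + a)]; ring
  have hQk₁ : 1 ≤ k₁ → Q k₁ = A := by
    intro h1
    rw [hQdef, if_neg (by omega : k₁ ≠ 0), if_pos rfl, if_neg (Ne.symm hPne), if_neg (Ne.symm hKne), if_neg (Ne.symm hGne)]; ring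
  have hQP : Q (k₁ + a) = B := by rw [hQdef, if_neg (by omega : k₁ + a ≠ 0), if_neg hPne, if_pos rfl, if_neg hPK, if_neg (Ne.symm hGneP)]; ring
  have hQK : Q k₂ = C := by rw [hQdef, if_neg hK0, if_neg hKne, if_neg (Ne.symm hPK), if_pos rfl, if_neg (Ne.symm hGneK)]; ring
  have hQG : Q (k₂ + a) = D := by rw [hQdef, if_neg (by omega : k₂ + a ≠ 0), if_neg hGne, if_neg hGneP, if_neg hGneK, if_pos rfl]; ring
  have hQoff : ∀ p, p ≠ 0 → p ≠ k₁ → p ≠ k₁ + a → p ≠ k₂ → p ≠ k₂ + a → Q p = 0 := fun p h0 h1 h2 h3 h4 => by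
    rw [hQdef, if_neg h0, if_neg h1, if_neg h2, if_neg h3, if_neg h4]; ring
  refine decAtT_congr (fun p => (hQp p).symm) ?_
  refine decAtT_of_flowAtT y t j (M + a) Q hy0 hy1 qM q1 ?_
  obtain ⟨φ, hφdef⟩ : ∃ φ : ℕ → ℕ → ℝ, ∀ l h, φ l h =
      (if l = k₁ then ((if h = k₁ + a then x₁P else 0) + (if h = k₂ + a then x₁G else 0)) else 0)
      + (if l = k₂ then ((if h = k₁ + a then x₂P else 0) + (if h = k₂ + a then x₂G else 0)) else 0) :=
    ⟨fun l h => _, fun l h => rfl⟩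
  have hφ₁ : ∀ h, φ k₁ h = (if h = k₁ + a then x₁P else 0) + (if h = k₂ + a then x₁G else 0) := fun h => by
    rw [hφdef, if_pos rfl, if_neg (Ne.symm hKne)]; ring
  have hφ₂ : ∀ h, φ k₂ h = (if h = k₁ + a then x₂P else 0) + (if h = k₂ + a then x₂G else 0) := fun h => by
    rw [hφdef, if_neg hKne, if_pos rfl]; ring
  have hφne : ∀ l h, l ≠ k₁ → l ≠ k₂ → φ l h = 0 := fun l h hl1 hl2 => by rw [hφdef, if_neg hl1, if_neg hl2]; ring
  have hφ₁P : φ k₁ (k₁ + a) = x₁P := by rw [hφ₁, if_pos rfl, if_neg (Ne.symm hGneP)]; ring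
  have hφ₁G : φ k₁ (k₂ + a) = x₁G := by rw [hφ₁, if_neg hGneP, if_pos rfl]; ring
  have hφ₂P : φ k₂ (k₁ + a) = x₂P := by rw [hφ₂, if_pos rfl, if_neg (Ne.symm hGneP)]; ring
  have hφ₂G : φ k₂ (k₂ + a) = x₂G := by rw [hφ₂, if_neg hGneP, if_pos rfl]; ring
  have hφ₁off : ∀ h, h ≠ k₁ + a → h ≠ k₂ + a → φ k₁ h = 0 := fun h h2 h3 => by rw [hφ₁, if_neg h2, if_neg h3]; ring
  have hφ₂off : ∀ h, h ≠ k₁ + a → h ≠ k₂ + a → φ k₂ h = 0 := fun h h2 h3 => by rw [hφ₂, if_neg h2, if_neg h3]; ring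
  have hφ0 : ∀ l h, 0 ≤ φ l h := by
    intro l h
    by_cases hl1 : l = k₁
    · rw [hl1, hφ₁]
      refine add_nonneg ?_ ?_ <;> split_ifs <;> first | exact le_rfl | assumption
    · by_cases hl2 : l = k₂
      · rw [hl2, hφ₂]
        refine add_nonneg ?_ ?_ <;> split_ifs <;> first | exact le_rfl | assumption
      · rw [hφne l h hl1 hl2]
  have hφ₁zero : k₁ = 0 → ∀ h, φ k₁ h = 0 := by
    intro h0 h
    obtain ⟨e1, e2⟩ := hzero₁ h0
    rw [hφ₁, e1, e2]; simp
  have htaM : ∀ h : ℕ, h ≤ j → h ≤ M + a → t < (h : ℝ) → y * (h : ℝ) ≤ t := by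
    intro h _ hhM _
    have hh : (h : ℝ) ≤ (M : ℝ) + a := by exact_mod_cast hhM
    have h1 : y * (h : ℝ) ≤ y * (M : ℝ) + y * a := by linarith [mul_le_mul_of_nonneg_left hh hy0.le, mul_add y (M : ℝ) (a : ℝ)]
    have h3 : y * (a : ℝ) ≤ (a : ℝ) * g * (1 - z) := by
      linarith [mul_le_mul_of_nonneg_right hyg (Nat.cast_nonneg a), show (1 - z) * g * (a : ℝ) = (a : ℝ) * g * (1 - z) by ring]
    rw [ht]; linarith
  have hload : ∀ h, ∑ l ∈ Finset.range (j + 1), usage y t j l h * φ l h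
      = usage y t j k₁ h * φ k₁ h + usage y t j k₂ h * φ k₂ h := by
    intro h
    have e : ∀ l ∈ Finset.range (j + 1), usage y t j l h * φ l h
        = (if l = k₁ then usage y t j k₁ h * φ k₁ h else 0) + (if l = k₂ then usage y t j k₂ h * φ k₂ h else 0) := by
      intro l _
      by_cases hl1 : l = k₁
      · subst hl1; rw [if_pos rfl, if_neg (Ne.symm hKne)]; ring
      · by_cases hl2 : l = k₂
        · subst hl2; rw [if_neg hKne, if_pos rfl]; ring
        · rw [if_neg hl1, if_neg hl2, hφne l h hl1 hl2]; ring
    rw [Finset.sum_congr rfl e, Finset.sum_add_distrib, Finset.sum_ite_eq' (Finset.range (j + 1)) k₁,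
      Finset.sum_ite_eq' (Finset.range (j + 1)) k₂, if_pos (Finset.mem_range.2 (Nat.lt_succ_of_le hk₁j)),
      if_pos (Finset.mem_range.2 (Nat.lt_succ_of_le hKj))]
  refine flowAtT_of_offers y t j (M + a) Q φ hy0 hy1 htpos q0 htaM hφ0 ?_ ?_ ?_ ?_
  · -- support of the routing
    intro l h hp
    by_cases hl1 : l = k₁
    · subst hl1
      have hl1' : 1 ≤ l := by
        by_contra hc
        have h0 : l = 0 := by omega
        rw [hφ₁zero h0 h] at hp; exact absurd hp (lt_irrefl _)
      refine ⟨⟨hl1', hk₁j, hk₁low⟩, ?_⟩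
      by_cases h2 : h = l + a
      · subst h2; rw [hφ₁P] at hp; exact ⟨by omega, Or.inr (hP₁comp hp)⟩
      · by_cases h3 : h = k₂ + a
        · subst h3; exact ⟨by omega, Or.inl hG⟩
        · rw [hφ₁off h h2 h3] at hp; exact absurd hp (lt_irrefl _)
    · by_cases hl2 : l = k₂
      · subst hl2
        refine ⟨⟨by omega, hKj, hKlow⟩, ?_⟩
        by_cases h2 : h = k₁ + a
        · subst h2; rw [hφ₂P] at hp; exact ⟨by omega, Or.inr (hP₂comp hp)⟩
        · by_cases h3 : h = l + a
          · subst h3; exact ⟨by omega, Or.inl hG⟩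
          · rw [hφ₂off h h2 h3] at hp; exact absurd hp (lt_irrefl _)
      · rw [hφne l h hl1 hl2] at hp; exact absurd hp (lt_irrefl _)
  · -- rows
    intro l hl1 hlj hlow
    by_cases hla : l = k₁
    · subst hla
      rw [Finset.sum_congr rfl (fun h _ => hφ₁ h), Finset.sum_add_distrib,
        Finset.sum_ite_eq' (Finset.range (M + a + 1)) (l + a), Finset.sum_ite_eq' (Finset.range (M + a + 1)) (k₂ + a),
        if_pos (Finset.mem_range.2 hPN), if_pos (Finset.mem_range.2 hGN), hQk₁ hl1, hsplit₁ hl1]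
    · by_cases hlb : l = k₂
      · subst hlb
        rw [Finset.sum_congr rfl (fun h _ => hφ₂ h), Finset.sum_add_distrib,
          Finset.sum_ite_eq' (Finset.range (M + a + 1)) (k₁ + a), Finset.sum_ite_eq' (Finset.range (M + a + 1)) (l + a),
          if_pos (Finset.mem_range.2 hPN), if_pos (Finset.mem_range.2 hGN), hQK, hsplit₂]
      · rw [Finset.sum_eq_zero (fun h _ => hφne l h hla hlb)]
        have hlP : l ≠ k₁ + a := by
          rintro rfl
          linarith
        rw [hQoff l (by omega) hla hlP hlb (by omega)]
  · -- columns
    intro h hhM habs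
    rw [hload h]
    by_cases h2 : h = k₁ + a
    · subst h2; rw [hφ₁P, hφ₂P, hQP]; exact hcapP
    · by_cases h3 : h = k₂ + a
      · subst h3; rw [hφ₁G, hφ₂G, hQG]; exact hcapG
      · rw [hφ₁off h h2 h3, hφ₂off h h2 h3, mul_zero, mul_zero, add_zero]
        exact q0 h
  · -- the zero's offer inequality
    have hPng : ¬ (j + 1 ≤ k₁ + a) := by omega
    have e : ∀ h ∈ Finset.range (M + a + 1),
        (if j + 1 ≤ h then t * (1 - y) / y else if t < (h : ℝ) then (h : ℝ) - t else 0)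
          * (Q h - ∑ l ∈ Finset.range (j + 1), usage y t j l h * φ l h)
        = (if h = k₁ + a then
            (if t < ((k₁ + a : ℕ) : ℝ) then ((k₁ + a : ℕ) : ℝ) - t else 0)
              * (B - (usage y t j k₁ (k₁ + a) * x₁P + usage y t j k₂ (k₁ + a) * x₂P)) else 0)
          + (if h = k₂ + a then t * (1 - y) / y
              * (D - (usage y t j k₁ (k₂ + a) * x₁G + usage y t j k₂ (k₂ + a) * x₂G)) else 0) := by
      intro h _
      rw [hload h]
      by_cases h2 : h = k₁ + a
      · subst h2
        rw [hQP, hφ₁P, hφ₂P, if_pos rfl, if_neg (Ne.symm hGneP), if_neg hPng]; ring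
      · rw [if_neg h2]
        by_cases h3 : h = k₂ + a
        · subst h3
          rw [hQG, hφ₁G, hφ₂G, if_pos rfl, if_pos hG]; ring
        · rw [if_neg h3, hφ₁off h h2 h3, hφ₂off h h2 h3, mul_zero, mul_zero, add_zero, sub_zero]
          by_cases h0 : h = 0
          · subst h0; rw [if_neg (by omega)]; push_cast; rw [if_neg (not_lt.2 htpos.le)]; ring
          · by_cases h4 : h = k₁
            · subst h4; rw [hQk₁ (by omega), if_neg (by omega), if_neg (by linarith)]; ring
            · by_cases h5 : h = k₂
              · subst h5; rw [hQK, if_neg (by omega), if_neg (by linarith)]; ring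
              · rw [hQoff h h0 h4 h2 h5 h3]; ring
    rw [Finset.sum_congr rfl e, Finset.sum_add_distrib,
      Finset.sum_ite_eq' (Finset.range (M + a + 1)) (k₁ + a), Finset.sum_ite_eq' (Finset.range (M + a + 1)) (k₂ + a),
      if_pos (Finset.mem_range.2 hPN), if_pos (Finset.mem_range.2 hGN), hQ0]
    have hz' : z + A * (if (0 : ℕ) = k₁ then (1 : ℝ) else 0) = z + (A - x₁P - x₁G) := by
      by_cases h0 : k₁ = 0
      · obtain ⟨e1, e2⟩ := hzero₁ h0
        rw [if_pos h0.symm, e1, e2]; ring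
      · rw [if_neg (Ne.symm h0), ← hsplit₁ (by omega)]; ring
    rw [hz']
    exact hoffer

/-- **ALL NONZERO LOWS INTO THE TWIN ⟹ `Q` IS DEC** (cell QK shape; no offer hypothesis).  If the twin `P = k₁ + a` can absorb the whole
low top `k₂` (mass `C`) and, when `k₁ ≥ 1`, also the whole low `k₁` (mass `A`; then `t < k₁ + P` is required), the zero fits the leftovers
automatically: by the mean identity `t·z = (k₁−t)A + (P−t)B + (K−t)C + (G−t)D`, termwise `(G−t)D ≤ t(1−y)/y·D` (`yG ≤ t`) and, when `t < P`,
`(P−t)·usage(l,P) ≤ t−l` (`usage_mid_mul_le`). [this work] -/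
theorem mixLawQ_decAtT_of_lowsAbsorb (y z g S lam : ℝ) (a j M k₁ k₂ : ℕ)
    (hy0 : 0 < y) (hy1 : y < 1) (hz0 : 0 ≤ z) (hz1 : z < 1) (hg1 : g ≤ 1) (hyg : y ≤ (1 - z) * g) (ha : 1 ≤ a)
    (hta : y * (M : ℝ) ≤ S) (hk : k₁ ≤ k₂) (hk₂M : k₂ ≤ M) (hlam0 : 0 ≤ lam) (hlam1 : lam ≤ 1)
    (hmean : (1 - z) * ((k₁ : ℝ) + ((k₂ : ℝ) - k₁) * lam) = S)
    (hk₁j : k₁ ≤ j) (hk₁low : 2 * (k₁ : ℝ) < S + (a : ℝ) * g * (1 - z))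
    (hPj : k₁ + a ≤ j) (hPmid : S + (a : ℝ) * g * (1 - z) ≤ 2 * ((k₁ + a : ℕ) : ℝ))
    (hKj : k₂ ≤ j) (hKlow : 2 * (k₂ : ℝ) < S + (a : ℝ) * g * (1 - z))
    (hG : j + 1 ≤ k₂ + a)
    (hcomp : 1 ≤ k₁ → S + (a : ℝ) * g * (1 - z) < (k₁ : ℝ) + ((k₁ + a : ℕ) : ℝ))
    (hfit : usage y (S + (a : ℝ) * g * (1 - z)) j k₁ (k₁ + a) * ((1 - z) * (1 - lam) * (1 - g) * (if 1 ≤ k₁ then (1 : ℝ) else 0))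
        + usage y (S + (a : ℝ) * g * (1 - z)) j k₂ (k₁ + a) * ((1 - z) * lam * (1 - g)) ≤ (1 - z) * (1 - lam) * g) :
    DECAtT y (S + (a : ℝ) * g * (1 - z)) j (M + a)
      (fun p => z * (if p = 0 then (1 : ℝ) else 0) + (1 - z) * slice (fun q => TP[k₁, k₂, lam, q]) a g p) := by
  set t : ℝ := S + (a : ℝ) * g * (1 - z) with ht
  set A : ℝ := (1 - z) * (1 - lam) * (1 - g) with hA
  set B : ℝ := (1 - z) * (1 - lam) * g with hB
  set C : ℝ := (1 - z) * lam * (1 - g) with hC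
  set D : ℝ := (1 - z) * lam * g with hD
  have hg0 : 0 < g := by
    by_contra hc
    linarith [mul_nonpos_of_nonneg_of_nonpos (by linarith : (0:ℝ) ≤ 1 - z) (not_lt.1 hc)]
  have h1z : 0 < 1 - z := by linarith
  have h1y : 0 < 1 - y := by linarith
  have hA0 : 0 ≤ A := mul_nonneg (mul_nonneg h1z.le (by linarith)) (by linarith)
  have hB0 : 0 ≤ B := mul_nonneg (mul_nonneg h1z.le (by linarith)) hg0.le
  have hC0 : 0 ≤ C := mul_nonneg (mul_nonneg h1z.le hlam0) (by linarith)
  have hD0 : 0 ≤ D := mul_nonneg (mul_nonneg h1z.le hlam0) hg0.le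
  have hkr : (k₁ : ℝ) ≤ k₂ := by exact_mod_cast hk
  have hk₁0 : (0 : ℝ) ≤ k₁ := Nat.cast_nonneg k₁
  have hk₂0 : (0 : ℝ) ≤ k₂ := Nat.cast_nonneg k₂
  have ht0 : 0 < t := by linarith
  have hPr : ((k₁ + a : ℕ) : ℝ) = (k₁ : ℝ) + a := by push_cast; ring
  have hmom : (k₁ : ℝ) * A + ((k₁ : ℝ) + a) * B + (k₂ : ℝ) * C + ((k₂ : ℝ) + a) * D = t := by
    rw [hA, hB, hC, hD, ht, ← hmean]; ring
  have hmass : z + A + B + C + D = 1 := by rw [hA, hB, hC, hD]; ring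
  have htz : t * z = -((t - k₁) * A) - (t - ((k₁ : ℝ) + a)) * B - (t - k₂) * C + ((k₂ : ℝ) + a - t) * D := by
    have e1 : t * z = t * (1 - A - B - C - D) := by rw [← hmass]; ring
    rw [e1]; linarith [hmom]
  have hyK : y * (k₂ : ℝ) ≤ S := (mul_le_mul_of_nonneg_left (by exact_mod_cast hk₂M) hy0.le).trans hta
  have hya : y * (a : ℝ) ≤ (a : ℝ) * g * (1 - z) := by
    linarith [mul_le_mul_of_nonneg_right hyg (Nat.cast_nonneg a), show (1 - z) * g * (a : ℝ) = (a : ℝ) * g * (1 - z) by ring]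
  have hyG : y * ((k₂ : ℝ) + a) ≤ t := by rw [mul_add, ht]; linarith
  have hyP : y * (((k₁ + a : ℕ) : ℝ)) ≤ t := by
    rw [hPr, mul_add, ht]
    have : y * (k₁ : ℝ) ≤ y * k₂ := mul_le_mul_of_nonneg_left hkr hy0.le
    linarith
  set x₁ : ℝ := A * (if 1 ≤ k₁ then (1 : ℝ) else 0) with hx₁
  have hx₁0 : 0 ≤ x₁ := mul_nonneg hA0 (by split_ifs <;> norm_num)
  have hx₁A : (k₁ : ℝ) * A - t * x₁ = -((t - k₁) * x₁) := by
    rcases Nat.eq_zero_or_pos k₁ with h0 | hpos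
    · subst h0; rw [hx₁, if_neg (by omega)]; push_cast; ring
    · rw [hx₁, if_pos (show 1 ≤ k₁ from hpos)]; ring
  refine mixLawQ_decAtT_of_routing_low y z g S lam a j M k₁ k₂ x₁ 0 C 0 hy0 hy1 hz0 hz1 hg1 hyg ha hta hk hk₂M hlam0 hlam1
    hmean hk₁j hk₁low hPj hPmid hKj hKlow hG hx₁0 le_rfl hC0 le_rfl
    (fun h1 => by rw [hx₁, if_pos h1]; ring) (fun h0 => ⟨by rw [hx₁, if_neg (by omega)]; ring, rfl⟩) (by ring)
    (fun hx => hcomp (by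
      by_contra hc
      rw [hx₁, if_neg hc, mul_zero] at hx
      exact lt_irrefl _ hx)) hfit (by rw [mul_zero, mul_zero, add_zero]; exact hD0) ?_
  change t * (z + (A - x₁ - 0)) ≤ (if t < ((k₁ + a : ℕ) : ℝ) then ((k₁ + a : ℕ) : ℝ) - t else 0)
      * (B - (usage y t j k₁ (k₁ + a) * x₁ + usage y t j k₂ (k₁ + a) * C))
    + t * (1 - y) / y * (D - (usage y t j k₁ (k₂ + a) * 0 + usage y t j k₂ (k₂ + a) * 0))
  simp only [mul_zero, add_zero, sub_zero]
  have hGterm : ((k₂ : ℝ) + a - t) * D ≤ t * (1 - y) / y * D := by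
    refine mul_le_mul_of_nonneg_right ?_ hD0
    rw [le_div_iff₀ hy0]
    nlinarith
  have hLHS : t * (z + (A - x₁)) = -((t - k₁) * x₁) - (t - ((k₁ : ℝ) + a)) * B - (t - k₂) * C + ((k₂ : ℝ) + a - t) * D := by
    have e : t * (z + (A - x₁)) = t * z + ((k₁ : ℝ) * A - t * x₁) + (t - k₁) * A := by ring
    rw [e, hx₁A, htz]; ring
  rw [hLHS]
  set U₁ : ℝ := usage y t j k₁ (k₁ + a) with hU₁
  set U₂ : ℝ := usage y t j k₂ (k₁ + a) with hU₂
  set P' : ℝ := ((k₁ + a : ℕ) : ℝ) with hP'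
  have hPterm : -((t - k₁) * x₁) - (t - ((k₁ : ℝ) + a)) * B - (t - k₂) * C ≤ (if t < P' then P' - t else 0) * (B - (U₁ * x₁ + U₂ * C)) := by
    by_cases htP : t < P'
    · rw [if_pos htP]
      have h2 : U₂ * (P' - t) ≤ t - k₂ := usage_mid_mul_le y t j k₂ (k₁ + a) hy0 hy1 hKlow hPj (by linarith) hyP
      have h2' : U₂ * (P' - t) * C ≤ (t - k₂) * C := mul_le_mul_of_nonneg_right h2 hC0
      have h1' : U₁ * (P' - t) * x₁ ≤ (t - k₁) * x₁ := by
        rcases Nat.eq_zero_or_pos k₁ with h0 | hpos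
        · have : x₁ = 0 := by rw [hx₁, if_neg (by omega)]; ring
          rw [this, mul_zero, mul_zero]
        · exact mul_le_mul_of_nonneg_right (usage_mid_mul_le y t j k₁ (k₁ + a) hy0 hy1 hk₁low hPj (hcomp hpos) hyP) hx₁0
      have key : (P' - t) * (B - (U₁ * x₁ + U₂ * C)) - (-((t - k₁) * x₁) - (t - ((k₁ : ℝ) + a)) * B - (t - k₂) * C)
          = ((t - k₁) * x₁ - U₁ * (P' - t) * x₁) + ((t - k₂) * C - U₂ * (P' - t) * C) + (P' - ((k₁ : ℝ) + a)) * B := by ring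
      have hP0 : P' - ((k₁ : ℝ) + a) = 0 := by linarith [hPr]
      rw [hP0, zero_mul, add_zero] at key
      linarith [key, h1', h2']
    · rw [if_neg htP, zero_mul]
      have htP' : ((k₁ : ℝ) + a) ≤ t := by rw [← hPr]; exact not_lt.1 htP
      have e1 : 0 ≤ (t - k₁) * x₁ := mul_nonneg (by linarith) hx₁0
      have e2 : 0 ≤ (t - ((k₁ : ℝ) + a)) * B := mul_nonneg (by linarith) hB0
      have e3 : 0 ≤ (t - k₂) * C := mul_nonneg (by linarith) hC0
      linarith
  linarith [hPterm, hGterm]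

end LawDec
end Quant
end Summit.CriticalPhenomena.PercolationContinuityZ3.Theorems
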